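import Literature.AlgebraicGeometry.Resolution.QuadraticTransforms
import Literature.AlgebraicGeometry.Resolution.QuadraticTransformsRegular
import Literature.AlgebraicGeometry.Resolution.RegularLocalOrder
import Mathlib.RingTheory.RegularLocalRing.Defs
import Mathlib.Algebra.CharP.Lemmas
import HarnessLib

/-!
# Q1 / Q2 — the quadratic-step lemmas of the Steer dictionary (chain W4.1, crux `Steer`)

Topic: `Summits/ResolutionOfSingularities/ResolutionOfSingularities/Theorems`. Helpers (seam **Q** of CHAIN
W4.1 v4.3 §B; signatures after res-L0-w41-plan-1's sketch `L/w41/Sketch-Q-quadratic-step.lean`, with the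
least-value hypotheses of Q2 replaced by the weaker `x ∈ R`, `v x < 1` and domination made explicit) shared by
seam T2 (`chart_step`, hypothesis `hdiv`) and by the `MultP` input of seam M of the registered stub
`stub_core4Dictionary` of the line `switching_dichotomy` r9 on `Theses.FrobeniusClosing.Steer`
(stmt-ResolutionOfSingularities-16345). No `Theses.*` / `Cruxes.*` import (chain build rule).

For a quadratic transform `R ⊂ R₁` ALONG a valuation ring `O` of `K` (`IsQuadraticTransformAlong`:
`R₁ = (R[𝔪_R/u₀])_{𝔪_O ∩ R[𝔪_R/u₀]}` for a generator `u₀` of `𝔪_R` of least value) with `R` DOMINATED by `O`: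

* `div_mem_of_isQuadraticTransformAlong` (**Q1**): for ANY least-value element `x` of the centre and every
  `y ∈ R` of positive value, `y / x ∈ R₁` (`y/x = (y/u₀)·(u₀/x)` and `x/u₀` is a unit of `R₁`).
* `exists_eq_div_pow_of_mem_blowupRing`, `div_pow_mem_blowupRing`: `R[𝔪/u₀] = ⋃_N 𝔪^N / u₀^N`.
* `not_mem_sq_of_forall_valuation_le` : a least-value element of `𝔪_R` is not in `𝔪_R²` (domination).
* `mul_pow_mem_maximalIdeal_pow` (**Q2**, `R` regular): if `a ∈ R₁` and `x ^ n * a ∈ R` for some `x ∈ R` of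
  positive value, then `x ^ n * a ∈ 𝔪_R ^ n` — the `𝔪_R`-adic order is non-negative on `R₁` (denominators of
  `R₁` have order exactly their `u₀`-exponent; `mul_not_mem_pow_of_not_mem_pow` = additivity of the order on
  a regular local ring, Zariski–Samuel VIII §1).
* `sub_pow_mem_maximalIdeal_pow_of_step` (**Q2, strict-step form**): along a strict step `s = x * s' + g`
  (`g ∈ R`, `s ^ p ∈ R`, `s' ^ p ∈ R₁`, characteristic `p`): `s ^ p - g ^ p = x ^ p * s' ^ p ∈ 𝔪_R ^ p`.

Everything here is OURS (campaign res-hironaka, rung L, slot W4.1); it replaces the role of no printed item and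
is NOT a statement of the manuscript under review [claim: Hironaka2017, status: under-review]. Classical
background: S. D. Cutkosky, *Introduction to Algebraic Geometry* / Abhyankar's quadratic transforms
(§2.1–2.2 of the tree's `QuadraticTransforms`), Zariski–Samuel II Ch. VIII §1 (order valuation).
-/

set_option linter.dupNamespace false

noncomputable section

open IsLocalRing Literature.AlgebraicGeometry.Resolution

namespace Summit.ResolutionOfSingularities.ResolutionOfSingularities.Theorems.SwitchingDichotomy.QuadraticStep

variable {K : Type} [Field K]

/-! ## Elements of positive value are non-units -/

/-- In a local subring `R ⊆ O` of `K`, an element of `O`-value `< 1` lies in the maximal ideal of `R`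
(its inverse, if in `R`, would lie in `O`). [folklore] -/
theorem mem_maximalIdeal_of_valuation_lt_one {O : ValuationSubring K} {R : Subring K} [IsLocalRing R]
    (hRO : R ≤ O.toSubring) (y : R) (hvy : O.valuation (y : K) < 1) : y ∈ maximalIdeal R := by
  rw [mem_maximalIdeal_iff_inv_not_mem]
  by_cases h0 : (y : K) = 0
  · exact Or.inl h0
  · refine Or.inr fun hinv => ?_
    have h1 : O.valuation (y : K)⁻¹ ≤ 1 := (O.valuation_le_one_iff _).mpr (hRO hinv)
    rw [map_inv₀, inv_le_one₀ (pos_iff_ne_zero.mpr ((map_ne_zero _).mpr h0))] at h1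
    exact not_lt.mpr h1 hvy

/-! ## Q1 -/

/-- **Q1.** For the quadratic transform `R ⊂ R₁` along `O` of a subring `R` dominated by `O`, and ANY
least-value element `x` of the centre of `O` on `R` (`v x < 1` maximal among the values `< 1` on `R`), every
`y ∈ R` of value `< 1` has `y / x ∈ R₁`: writing `R₁ = (R[𝔪/u₀])_{centre}` (`exists_eq_locAtCentre`),
`v x = v u₀`, so `y / x = (y / u₀) · (x / u₀)⁻¹` with `y / u₀ ∈ R[𝔪/u₀]` (`div_mem_blowupRing`) and `x / u₀` a
unit of `R₁` (`inv_mem_locAtCentre`). [folklore] -/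
theorem div_mem_of_isQuadraticTransformAlong {O : ValuationSubring K} {R R₁ : Subring K}
    (h : IsQuadraticTransformAlong O R R₁) (hdom : SubringDominates R O.toSubring)
    {x : K} (hxR : x ∈ R) (hx0 : x ≠ 0) (hvx : O.valuation x < 1)
    (hmax : ∀ y ∈ R, O.valuation y < 1 → O.valuation y ≤ O.valuation x)
    {y : K} (hy : y ∈ R) (hvy : O.valuation y < 1) : y / x ∈ R₁ := by
  obtain ⟨hloc, u₀, hu₀m, hu₀0, hval, hR₁⟩ := h.exists_eq_locAtCentre
  have hRO : R ≤ O.toSubring := h.source_le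
  have hvu₀ : O.valuation (u₀ : K) < 1 :=
    ((subringDominates_valuationSubring_iff hRO).mp hdom u₀).mp hu₀m
  have hxm : (⟨x, hxR⟩ : R) ∈ maximalIdeal R := mem_maximalIdeal_of_valuation_lt_one hRO _ hvx
  have hym : (⟨y, hy⟩ : R) ∈ maximalIdeal R := mem_maximalIdeal_of_valuation_lt_one hRO _ hvy
  have hvxu : O.valuation x = O.valuation (u₀ : K) :=
    le_antisymm (hval ⟨x, hxR⟩ hxm) (hmax _ u₀.2 hvu₀)
  have hu₀K : (u₀ : K) ≠ 0 := fun h0 => hu₀0 (Subtype.ext h0)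
  set B := blowupRing R (u₀ : K) with hB
  have hyB : y / (u₀ : K) ∈ B := div_mem_blowupRing (u₀ : K) hym
  have hxB : x / (u₀ : K) ∈ B := div_mem_blowupRing (u₀ : K) hxm
  have hv1 : O.valuation (x / (u₀ : K)) = 1 := by
    rw [map_div₀, hvxu, div_self ((map_ne_zero _).mpr hu₀K)]
  have hinv : (x / (u₀ : K))⁻¹ ∈ locAtCentre B O := inv_mem_locAtCentre (le_locAtCentre B O hxB) hv1
  have heq : y / x = y / (u₀ : K) * (x / (u₀ : K))⁻¹ := by
    field_simp
  rw [hR₁, heq]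
  exact Subring.mul_mem _ (le_locAtCentre B O hyB) hinv

/-! ## The blow-up ring `R[𝔪/u₀]` as `⋃ 𝔪^N / u₀^N` -/

/-- Every element of `R[𝔪/u₀]` is `c / u₀ ^ N` with `c ∈ 𝔪_R ^ N` for some `N`. [folklore] -/
theorem exists_eq_div_pow_of_mem_blowupRing {R : Subring K} [IsLocalRing R] {u₀ : R}
    (hu₀ : u₀ ∈ maximalIdeal R) (hu₀K : (u₀ : K) ≠ 0) {b : K} (hb : b ∈ blowupRing R (u₀ : K)) :
    ∃ (N : ℕ) (c : R), c ∈ maximalIdeal R ^ N ∧ b = (c : K) / (u₀ : K) ^ N := by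
  unfold blowupRing at hb
  induction hb using Subring.closure_induction with
  | mem z hz =>
    rcases hz with hz | ⟨y, hy, rfl⟩
    · exact ⟨0, ⟨z, hz⟩, by simp, by simp⟩
    · exact ⟨1, y, by simpa using hy, by simp⟩
  | zero => exact ⟨0, 0, by simp, by simp⟩
  | one => exact ⟨0, 1, by simp, by simp⟩
  | add a b _ _ ha hb =>
    obtain ⟨N, c, hc, rfl⟩ := ha
    obtain ⟨M, d, hd, rfl⟩ := hb
    refine ⟨N + M, c * u₀ ^ M + d * u₀ ^ N, ?_, ?_⟩
    · rw [pow_add]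
      refine add_mem (Ideal.mul_mem_mul hc (Ideal.pow_mem_pow hu₀ M)) ?_
      rw [mul_comm (maximalIdeal R ^ N)]
      exact Ideal.mul_mem_mul hd (Ideal.pow_mem_pow hu₀ N)
    · push_cast
      field_simp
      ring
  | neg a _ ha =>
    obtain ⟨N, c, hc, rfl⟩ := ha
    exact ⟨N, -c, neg_mem hc, by push_cast; ring⟩
  | mul a b _ _ ha hb =>
    obtain ⟨N, c, hc, rfl⟩ := ha
    obtain ⟨M, d, hd, rfl⟩ := hb
    refine ⟨N + M, c * d, by rw [pow_add]; exact Ideal.mul_mem_mul hc hd, ?_⟩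
    push_cast
    rw [pow_add, div_mul_div_comm]

/-- Conversely `𝔪_R ^ L / u₀ ^ L ⊆ R[𝔪/u₀]`. [folklore] -/
theorem div_pow_mem_blowupRing {R : Subring K} [IsLocalRing R] (u₀ : R) {L : ℕ} {c : R}
    (hc : c ∈ maximalIdeal R ^ L) : (c : K) / (u₀ : K) ^ L ∈ blowupRing R (u₀ : K) := by
  induction L generalizing c with
  | zero =>
    rw [pow_zero, div_one]
    exact le_blowupRing _ _ c.2
  | succ L ih =>
    rw [pow_succ] at hc
    refine Submodule.mul_induction_on hc ?_ ?_
    · intro m hm n hn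
      have : ((m * n : R) : K) / (u₀ : K) ^ (L + 1) = (m : K) / (u₀ : K) ^ L * ((n : K) / (u₀ : K)) := by
        push_cast
        rw [pow_succ, div_mul_div_comm]
      rw [this]
      exact Subring.mul_mem _ (ih hm) (div_mem_blowupRing _ hn)
    · intro a b ha hb
      push_cast
      rw [add_div]
      exact Subring.add_mem _ ha hb

/-! ## Least-value generators are minimal generators -/

/-- A least-value element `u₀` of the maximal ideal of a local subring `R` dominated by `O` (every
`y ∈ 𝔪_R` has `v y ≤ v u₀`) does not lie in `𝔪_R ²`: a product `m · n` of elements of `𝔪_R` has value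
`v m · v n ≤ v u₀ · v n < v u₀` (domination: `v n < 1`). [folklore] -/
theorem not_mem_sq_of_forall_valuation_le {O : ValuationSubring K} {R : Subring K} [IsLocalRing R]
    (hdom : SubringDominates R O.toSubring) {u₀ : R} (hu₀K : (u₀ : K) ≠ 0)
    (hval : ∀ y ∈ maximalIdeal R, O.valuation (y : K) ≤ O.valuation (u₀ : K)) :
    u₀ ∉ maximalIdeal R ^ 2 := by
  have hRO : R ≤ O.toSubring := hdom.1
  have hv0 : O.valuation (u₀ : K) ≠ 0 := (map_ne_zero _).mpr hu₀K
  have key : ∀ z ∈ maximalIdeal R * maximalIdeal R, O.valuation (z : K) < O.valuation (u₀ : K) := by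
    intro z hz
    refine Submodule.mul_induction_on hz ?_ ?_
    · intro m hm n hn
      have hm' := hval m hm
      have hn' : O.valuation (n : K) < 1 :=
        ((subringDominates_valuationSubring_iff hRO).mp hdom n).mp hn
      calc O.valuation ((m * n : R) : K) = O.valuation (m : K) * O.valuation (n : K) := by
            push_cast
            exact map_mul _ _ _
        _ ≤ O.valuation (u₀ : K) * O.valuation (n : K) := mul_le_mul' hm' le_rfl
        _ < O.valuation (u₀ : K) * 1 := mul_lt_mul_of_pos_left hn' (zero_lt_iff.mpr hv0)
        _ = O.valuation (u₀ : K) := mul_one _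
    · intro a b ha hb
      calc O.valuation ((a + b : R) : K) ≤ max (O.valuation (a : K)) (O.valuation (b : K)) := by
            push_cast
            exact Valuation.map_add _ _ _
        _ < O.valuation (u₀ : K) := max_lt ha hb
  intro h2
  rw [pow_two] at h2
  exact lt_irrefl _ (key u₀ h2)

/-! ## Q2 -/

/-- **Q2 (core).** Let `R ⊂ R₁` be a quadratic transform along `O` of a REGULAR local subring `R` dominated
by `O`, and `x ∈ R` of value `< 1`. If `a ∈ R₁` and `x ^ n * a ∈ R` then `x ^ n * a ∈ 𝔪_R ^ n` — the
`𝔪_R`-adic order valuation is non-negative on `R₁`. Proof: `R₁ = (R[𝔪/u₀])_{centre}`, `a = b / c` with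
`b = b₀ / u₀^N`, `c = c₀ / u₀^M`, `b₀ ∈ 𝔪^N`, `c₀ ∈ 𝔪^M`, and `v c = 1` forces `c₀ ∉ 𝔪^{M+1}`; also
`u₀ ∉ 𝔪²`. From `(x^n a) · c₀ · u₀^N = x^n · b₀ · u₀^M ∈ 𝔪^{n+N+M}` and the additivity of the order on the
regular local ring `R` (`mul_not_mem_pow_of_not_mem_pow`), `x^n a ∈ 𝔪^n`.
[cite: ZariskiSamuel1960, Ch. VIII §1 Thm. 1] [folklore] -/
theorem mul_pow_mem_maximalIdeal_pow {O : ValuationSubring K} {R R₁ : Subring K} [IsRegularLocalRing R]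
    (h : IsQuadraticTransformAlong O R R₁) (hdom : SubringDominates R O.toSubring)
    {x : K} (hxR : x ∈ R) (hvx : O.valuation x < 1)
    {a : K} (ha : a ∈ R₁) (n : ℕ) (hxa : x ^ n * a ∈ R) :
    (⟨x ^ n * a, hxa⟩ : R) ∈ maximalIdeal R ^ n := by
  classical
  obtain ⟨hloc, u₀, hu₀m, hu₀0, hval, hR₁⟩ := h.exists_eq_locAtCentre
  have hRO : R ≤ O.toSubring := h.source_le
  have hvu₀ : O.valuation (u₀ : K) < 1 :=
    ((subringDominates_valuationSubring_iff hRO).mp hdom u₀).mp hu₀m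
  have hu₀K : (u₀ : K) ≠ 0 := fun h0 => hu₀0 (Subtype.ext h0)
  have hu₀2 : u₀ ∉ maximalIdeal R ^ 2 := not_mem_sq_of_forall_valuation_le hdom hu₀K hval
  have hxm : (⟨x, hxR⟩ : R) ∈ maximalIdeal R := mem_maximalIdeal_of_valuation_lt_one hRO _ hvx
  set B := blowupRing R (u₀ : K) with hB
  have hBO : B ≤ O.toSubring := (le_locAtCentre B O).trans (hR₁ ▸ h.target_le)
  -- `a = b / c`, `b = b₀/u₀^N`, `c = c₀/u₀^M`, `v c = 1`
  rw [hR₁] at ha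
  obtain ⟨b, hb, c, hc, hvc, rfl⟩ := ha
  obtain ⟨N, b₀, hb₀, rfl⟩ := exists_eq_div_pow_of_mem_blowupRing hu₀m hu₀K hb
  obtain ⟨M, c₀, hc₀, hc⟩ := exists_eq_div_pow_of_mem_blowupRing hu₀m hu₀K hc
  -- `c₀ ∉ 𝔪^{M+1}` since `v c = 1`
  have hc₀M : c₀ ∉ maximalIdeal R ^ (M + 1) := by
    intro hmem
    have hq : (c₀ : K) / (u₀ : K) ^ (M + 1) ∈ B := div_pow_mem_blowupRing u₀ hmem
    have hle : O.valuation ((c₀ : K) / (u₀ : K) ^ (M + 1)) ≤ 1 := (O.valuation_le_one_iff _).mpr (hBO hq)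
    have hc' : c = (u₀ : K) * ((c₀ : K) / (u₀ : K) ^ (M + 1)) := by
      rw [hc]
      field_simp
      ring
    have : O.valuation c < 1 := by
      rw [hc', map_mul]
      calc O.valuation (u₀ : K) * O.valuation ((c₀ : K) / (u₀ : K) ^ (M + 1))
          ≤ O.valuation (u₀ : K) * 1 := mul_le_mul' le_rfl hle
        _ < 1 := by rw [mul_one]; exact hvu₀
    rw [hvc] at this
    exact lt_irrefl _ this
  have hc₀K : (c₀ : K) ≠ 0 := by
    intro h0
    rw [hc, h0, zero_div, map_zero] at hvc
    exact zero_ne_one hvc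
  -- the integral equation `(x^n a) · c₀ · u₀^N = x^n · b₀ · u₀^M` in `R`
  have heqK : x ^ n * ((b₀ : K) / (u₀ : K) ^ N / c) * (c₀ : K) * (u₀ : K) ^ N =
      x ^ n * (b₀ : K) * (u₀ : K) ^ M := by
    rw [hc]
    field_simp
  have heqR : (⟨x ^ n * ((b₀ : K) / (u₀ : K) ^ N / c), hxa⟩ : R) * c₀ * u₀ ^ N =
      ⟨x, hxR⟩ ^ n * b₀ * u₀ ^ M := Subtype.ext (by push_cast; exact heqK)
  -- the right-hand side lies in `𝔪^{n+N+M}`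
  have hrhs : (⟨x, hxR⟩ : R) ^ n * b₀ * u₀ ^ M ∈ maximalIdeal R ^ (n + N + M) := by
    rw [pow_add, pow_add]
    exact Ideal.mul_mem_mul (Ideal.mul_mem_mul (Ideal.pow_mem_pow hxm n) hb₀) (Ideal.pow_mem_pow hu₀m M)
  -- powers of `u₀` have the expected order
  have hu₀pow : ∀ L : ℕ, u₀ ^ L ∉ maximalIdeal R ^ (L + 1) := by
    intro L
    induction L with
    | zero =>
      rw [pow_zero, zero_add, pow_one]
      exact fun h1 => (maximalIdeal.isMaximal R).ne_top (Ideal.eq_top_of_isUnit_mem _ h1 isUnit_one)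
    | succ L ih =>
      rw [pow_succ u₀ L]
      exact mul_not_mem_pow_of_not_mem_pow ih hu₀2
  -- conclude by additivity of the order
  rcases Nat.eq_zero_or_pos n with hn | hn
  · subst hn
    rw [pow_zero, Ideal.one_eq_top]
    exact Submodule.mem_top
  · obtain ⟨n', rfl⟩ : ∃ n', n = n' + 1 := ⟨n - 1, (Nat.sub_add_cancel hn).symm⟩
    by_contra hr
    have h1 := mul_not_mem_pow_of_not_mem_pow hr hc₀M
    have h2 := mul_not_mem_pow_of_not_mem_pow h1 (hu₀pow N)
    rw [heqR] at h2
    have hidx : n' + 1 + N + M = n' + M + N + 1 := by ring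
    rw [hidx] at hrhs
    exact h2 hrhs

/-- **Q2 (strict-step form = the `MultP` input of the dictionary's seam M).** Along a strict step
`s = x * s' + g` (`g ∈ R`, `x ∈ R` of positive value) with `s ^ p ∈ R` and `s' ^ p ∈ R₁`, in characteristic
`p`: `s ^ p - g ^ p = x ^ p * s' ^ p ∈ 𝔪_R ^ p`. [folklore] -/
theorem sub_pow_mem_maximalIdeal_pow_of_step {O : ValuationSubring K} {R R₁ : Subring K}
    [IsRegularLocalRing R] (h : IsQuadraticTransformAlong O R R₁) (hdom : SubringDominates R O.toSubring)
    (p : ℕ) [Fact p.Prime] [CharP K p]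
    {s s' x g : K} (hs : s ^ p ∈ R) (hs' : s' ^ p ∈ R₁) (hxR : x ∈ R) (hvx : O.valuation x < 1)
    (hg : g ∈ R) (hstep : s = x * s' + g) :
    (⟨s ^ p - g ^ p, sub_mem hs (pow_mem hg p)⟩ : R) ∈ maximalIdeal R ^ p := by
  have heq : s ^ p - g ^ p = x ^ p * s' ^ p := by
    rw [hstep, add_pow_char, mul_pow]
    ring
  have hxa : x ^ p * s' ^ p ∈ R := by
    rw [← heq]
    exact sub_mem hs (pow_mem hg p)
  have hmem := mul_pow_mem_maximalIdeal_pow h hdom hxR hvx hs' p hxa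
  have hel : (⟨s ^ p - g ^ p, sub_mem hs (pow_mem hg p)⟩ : R) = ⟨x ^ p * s' ^ p, hxa⟩ := Subtype.ext heq
  rw [hel]
  exact hmem

end Summit.ResolutionOfSingularities.ResolutionOfSingularities.Theorems.SwitchingDichotomy.QuadraticStep

end
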